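import Summits.ValiantsHypothesis.ValiantsHypothesis.Theorems.DivisionGapDefs

/-!
# Crux `DivisionGap.PerDivisionHard` (stmt-ValiantsHypothesis-5065), line
`pair-descent-jss-endpoint` — stub `stub_walkBookkeepingTwin` (walk bookkeeping is a multiset invariant)

Seat c8 of the line builds the walk-sum cofactor: a sum over closed walks
`C_0, R_1, C_1, …, R_L, C_L = C_0` of products of step monomials
`x_{R_t C_{t-1}} · x_{R_t C_t}² · (bookkeeping)`, where the bookkeeping of step `t` is
`∏_{R' ≠ R_t} x_{R' a₀}³ · ∏_{C ≠ C_{t-1}} x_{ρ₀ C} · ∏_{C ≠ C_t} x_{ρ₀ C}²` for a bookkeeping row `ρ₀`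
and a default column `a₀`.  This file proves the purely algebraic fact that the bookkeeping part of a
walk's exponent,

`B(rows, cin, cout) = Σ_t [Σ_{R' ≠ rows t} 3e_{(R',a₀)} + Σ_{C ≠ cin t} e_{(ρ₀,C)} + Σ_{C ≠ cout t} 2e_{(ρ₀,C)}]`,

depends only on the MULTISETS of `rows`, `cin`, `cout`: if `rows' = rows ∘ σ` and
`cin' = m ∘ τ₁`, `cout' = m ∘ τ₂`, `cin = m ∘ τ₃`, `cout = m ∘ τ₄` for permutations `σ, τᵢ` of `Fin L`
and one column list `m`, then `B(rows, cin, cout) = B(rows', cin', cout')`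
(`stub_walkBookkeepingTwin`).  For a closed walk the in-columns `C_{t-1}` and the out-columns `C_t`
are rotations of the same cyclic list and the reversed walk swaps their roles, so a closed walk and its
reversal have the same bookkeeping and their exponents differ exactly by the walk's net flow.

Proof: split the summand into its three parts (`Finset.sum_add_distrib`) and reindex each of the
resulting sums along the given permutation (`Fintype.sum_equiv`, packaged as
`sum_comp_perm_reindex`).
-/

noncomputable section

-- `Summit.ValiantsHypothesis.ValiantsHypothesis.…` is the tree's mandated single-conjunct layout
-- (Sub = Summit), so the duplicated namespace component is intended.
set_option linter.dupNamespace false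

open scoped BigOperators

namespace Summit.ValiantsHypothesis.ValiantsHypothesis.Theorems.DivisionGapPerDivisionHard

/-- Reindexing a sum along a permutation: if `g = f ∘ τ` pointwise for a permutation `τ` of a finite
index type, then `∑ t, F (g t) = ∑ t, F (f t)` for every `F`. [folklore] -/
theorem sum_comp_perm_reindex {ι α M : Type*} [Fintype ι] [AddCommMonoid M] (τ : Equiv.Perm ι)
    (f g : ι → α) (h : ∀ t, g t = f (τ t)) (F : α → M) :
    ∑ t, F (g t) = ∑ t, F (f t) :=
  Fintype.sum_equiv τ (fun t => F (g t)) (fun t => F (f t)) fun t => by rw [h t]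

/-- **stub_walkBookkeepingTwin — the bookkeeping part of a walk's exponent is a multiset invariant.**
With `B(rows, cin, cout) = Σ_t [Σ_{R' ≠ rows t} 3e_{(R',a₀)} + Σ_{C ≠ cin t} e_{(ρ₀,C)} + Σ_{C ≠ cout t} 2e_{(ρ₀,C)}]`:
if `rows' = rows ∘ σ`, `cin' = m ∘ τ₁`, `cout' = m ∘ τ₂`, `cin = m ∘ τ₃`, `cout = m ∘ τ₄` for
permutations `σ, τ₁, τ₂, τ₃, τ₄` of `Fin L` and one column list `m`, then
`B(rows, cin, cout) = B(rows', cin', cout')`.  Proof: `Finset.sum_add_distrib` splits both sides into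
the row part, the in-column part and the out-column part; the row parts agree after reindexing along
`σ`, and each column part equals the corresponding sum for the list `m` after reindexing along its
`τᵢ`. [folklore] -/
theorem stub_walkBookkeepingTwin :
    ∀ (n L : ℕ) (ρ₀ a₀ : Fin n) (rows rows' : Fin L → Fin n) (cin cout cin' cout' m : Fin L → Fin n)
      (σ τ₁ τ₂ τ₃ τ₄ : Equiv.Perm (Fin L)),
      (∀ t, rows' t = rows (σ t)) → (∀ t, cin' t = m (τ₁ t)) → (∀ t, cout' t = m (τ₂ t)) →
      (∀ t, cin t = m (τ₃ t)) → (∀ t, cout t = m (τ₄ t)) →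
      (∑ t : Fin L, (∑ R' ∈ Finset.univ.erase (rows t), Finsupp.single (R', a₀) 3 +
          ∑ C ∈ Finset.univ.erase (cin t), Finsupp.single (ρ₀, C) 1 +
          ∑ C ∈ Finset.univ.erase (cout t), Finsupp.single (ρ₀, C) 2) : (Fin n × Fin n) →₀ ℕ) =
      ∑ t : Fin L, (∑ R' ∈ Finset.univ.erase (rows' t), Finsupp.single (R', a₀) 3 +
          ∑ C ∈ Finset.univ.erase (cin' t), Finsupp.single (ρ₀, C) 1 +
          ∑ C ∈ Finset.univ.erase (cout' t), Finsupp.single (ρ₀, C) 2) := by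
  intro n L ρ₀ a₀ rows rows' cin cout cin' cout' m σ τ₁ τ₂ τ₃ τ₄ hrows hcin' hcout' hcin hcout
  simp only [Finset.sum_add_distrib]
  rw [sum_comp_perm_reindex σ rows rows' hrows
      (fun R => ∑ R' ∈ Finset.univ.erase R, (Finsupp.single (R', a₀) 3 : (Fin n × Fin n) →₀ ℕ)),
    sum_comp_perm_reindex τ₁ m cin' hcin'
      (fun C₀ => ∑ C ∈ Finset.univ.erase C₀, (Finsupp.single (ρ₀, C) 1 : (Fin n × Fin n) →₀ ℕ)),
    sum_comp_perm_reindex τ₂ m cout' hcout'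
      (fun C₀ => ∑ C ∈ Finset.univ.erase C₀, (Finsupp.single (ρ₀, C) 2 : (Fin n × Fin n) →₀ ℕ)),
    sum_comp_perm_reindex τ₃ m cin hcin
      (fun C₀ => ∑ C ∈ Finset.univ.erase C₀, (Finsupp.single (ρ₀, C) 1 : (Fin n × Fin n) →₀ ℕ)),
    sum_comp_perm_reindex τ₄ m cout hcout
      (fun C₀ => ∑ C ∈ Finset.univ.erase C₀, (Finsupp.single (ρ₀, C) 2 : (Fin n × Fin n) →₀ ℕ))]

end Summit.ValiantsHypothesis.ValiantsHypothesis.Theorems.DivisionGapPerDivisionHard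

end
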